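import Summits.QuantumFields.BalabanUV.T4Continuum.Support.NE7K1LinTorusResolventInverse
import Literature.MathematicalPhysics.QuantumFieldTheory.Balaban1983to89.B4BoxCov237

/-!
# NE7K1LinTorusRho — row NE7 (node U5), candidate route HOM, path H1L, cell K1-lin(s): the TORUS PSEUDO-DISTANCE of the unit representatives
# `ρ_𝕋(y,y′) = dist_{Π_μ ℤ∕P_μ}(y − y′)` (sup of the circular distances), its pseudo-distance axioms and its uniform lattice-sum profile
# `Σ_{y′} e^{−tρ_𝕋(y,y′)} ≤ latticeConst(d+1, t)` — the metric input of the torus variant of B4 (2.37) (file 84 `NE7K1LinTorusCov237`)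

Lineage `b2b-balaban-t4-ne7-p2` (CRUX PROVER NE7 #2), generation 77; file 84a.  **`rhoT_isPseudoDist`** (b04's `B4Sect5Torus.circAbs_neg ∕ circAbs_add_le` BY NAME) (`B4Sect5Torus.IsPseudoDist`), `rhoT_le_supNorm`, `eq_of_sub_eq_period`, and
**`rhoT_sumBound`** (`B4Sect5Torus.SumBound (rhoT P) (latticeConst (d+1))`: the centred representatives of `y − y′` are pairwise distinct lattice points,
`supNorm_translate_centreVec`, b04's `latticeSum_le`).

HONEST FRAMING: [folklore] lattice bookkeeping; no estimate of Bałaban's; no `sorry`.  Census only; NE7 NOT PRINTED ∕ NOT PROVED; spine 0∕9; FIXED FINITE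
T⁴, rung (B)+1; NOT infinite volume, NOT mass gap, NOT Clay.  HONEST DEPENDENCY: continuum YM on T⁴ ⇐ BetaPertH ∧ nine spine estimates (0/9 proved);
BetaPertH ⇐ (D1) ∧ (D4) ∧ CAP+tail; G-an2-4 gates asym, D1 and NE2/3/4.
-/

noncomputable section

open Finset Matrix

namespace Summit.QuantumFields.BalabanUV.T4Continuum.NE7K1LinTorusRho

open Literature.MathematicalPhysics.QuantumFieldTheory.Balaban1983to89
open Literature.MathematicalPhysics.QuantumFieldTheory.Balaban1983to89.B4Reflection242
open Literature.MathematicalPhysics.QuantumFieldTheory.Balaban1983to89.B4ContourShift (supNorm supNorm_nonneg abs_le_supNorm)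
open Literature.MathematicalPhysics.QuantumFieldTheory.Balaban1983to89.B4TorusKernel.MultiPeriod (torusSupNorm circAbs centre centreVec
  translate circAbs_add_mul abs_add_mul_centre circAbs_le_abs circAbs_nonneg supNorm_translate_centreVec torusSupNorm_le_supNorm)
open Literature.MathematicalPhysics.QuantumFieldTheory.Balaban1983to89.B4TorusPositivity (wrap)
open Literature.MathematicalPhysics.QuantumFieldTheory.Balaban1983to89.B4Sect5Torus (IsPseudoDist SumBound)
open Literature.MathematicalPhysics.QuantumFieldTheory.Balaban1983to89.B4Sect5Proof (latticeConst latticeSum_le)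
open NE7K1LinFoldKernels

variable {d : ℕ}

/-! ### §2 The torus pseudo-distance on the unit representatives -/

section Rho

variable {P : Fin (d + 1) → ℕ}

/-- THE TORUS PSEUDO-DISTANCE of unit representatives: `ρ_𝕋(y,y′) = dist_{Π ℤ∕P}(y − y′)` (sup over coordinates of the circular distance). [folklore] -/
def rhoT (P : Fin (d + 1) → ℕ) (y y' : ↥(boxDom P)) : ℝ := torusSupNorm P (y.1 - y'.1)

/-- `ρ_𝕋` is a pseudo-distance. [folklore] -/
theorem rhoT_isPseudoDist (hP : ∀ i, 1 ≤ P i) : IsPseudoDist (rhoT P) where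
  symm := fun y y' => by
    unfold rhoT torusSupNorm
    congr 1; funext i
    rw [show (y'.1 - y.1) i = -((y.1 - y'.1) i) by simp [Pi.sub_apply], B4Sect5Torus.circAbs_neg (hP i)]
  zero := fun y => by
    unfold rhoT torusSupNorm
    simp only [sub_self, Pi.zero_apply]
    have h : ∀ i : Fin (d + 1), ((circAbs (P i) 0 : ℤ) : ℝ) = 0 := fun i => by
      unfold circAbs; simp
    simp only [h]
    exact le_antisymm (Finset.sup'_le _ _ fun i _ => le_rfl) (Finset.le_sup' (fun _ : Fin (d + 1) => (0 : ℝ)) (Finset.mem_univ 0))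
  triangle := fun x y z => by
    unfold rhoT torusSupNorm
    refine Finset.sup'_le _ _ fun i _ => ?_
    have h := B4Sect5Torus.circAbs_add_le (hP i) ((x.1 - y.1) i) ((y.1 - z.1) i)
    have e : (x.1 - y.1) i + (y.1 - z.1) i = (x.1 - z.1) i := by simp only [Pi.sub_apply]; ring
    rw [e] at h
    have h' : ((circAbs (P i) ((x.1 - z.1) i) : ℤ) : ℝ) ≤ ((circAbs (P i) ((x.1 - y.1) i) : ℤ) : ℝ) + ((circAbs (P i) ((y.1 - z.1) i) : ℤ) : ℝ) := by
      exact_mod_cast h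
    exact h'.trans (add_le_add (Finset.le_sup' (fun i => ((circAbs (P i) ((x.1 - y.1) i) : ℤ) : ℝ)) (Finset.mem_univ i))
      (Finset.le_sup' (fun i => ((circAbs (P i) ((y.1 - z.1) i) : ℤ) : ℝ)) (Finset.mem_univ i)))

/-- `ρ_𝕋 ≤ |y − y′|_∞`. [folklore] -/
theorem rhoT_le_supNorm (hP : ∀ i, 1 ≤ P i) (y y' : ↥(boxDom P)) : rhoT P y y' ≤ supNorm (y.1 - y'.1) :=
  torusSupNorm_le_supNorm hP _

/-- two box points congruent modulo the periods are equal. [folklore] -/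
theorem eq_of_sub_eq_period {y y' : Fin (d + 1) → ℤ} (hy : y ∈ boxDom P) (hy' : y' ∈ boxDom P) {m : Fin (d + 1) → ℤ}
    (h : y = y' + fun i => (P i : ℤ) * m i) : y = y' := by
  have h1 : wrap P y = wrap P y' := by rw [h, NE7K1LinTorusLineInvariant.wrap_add_period]
  rwa [wrap_eq_self hy, wrap_eq_self hy'] at h1

/-- **THE LATTICE-SUM PROFILE OF `ρ_𝕋`**: `Σ_{y′} e^{−tρ_𝕋(y,y′)} ≤ latticeConst(d+1, t)` (centred representatives of `y − y′` are pairwise distinct lattice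
points; b04's `latticeSum_le`). [folklore] -/
theorem rhoT_sumBound (hP : ∀ i, 1 ≤ P i) : SumBound (rhoT P) (latticeConst (d + 1)) := by
  classical
  intro t ht y
  -- the centred representative of `y − y′`
  set c : ↥(boxDom P) → (Fin (d + 1) → ℤ) := fun y' => translate P (y.1 - y'.1) (centreVec P (y.1 - y'.1)) with hc
  have hinj : Function.Injective c := by
    intro y₁ y₂ h
    apply Subtype.ext
    have h' : translate P (y.1 - y₁.1) (centreVec P (y.1 - y₁.1)) = translate P (y.1 - y₂.1) (centreVec P (y.1 - y₂.1)) := h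
    have : y₁.1 = y₂.1 + fun i => (P i : ℤ) * (centreVec P (y.1 - y₁.1) i - centreVec P (y.1 - y₂.1) i) := by
      funext i
      have := congrFun h' i
      simp only [B4TorusKernel.MultiPeriod.translate_apply, Pi.sub_apply] at this
      simp only [Pi.add_apply]
      linear_combination -this
    exact eq_of_sub_eq_period y₁.2 y₂.2 this
  have hρ : ∀ y', rhoT P y y' = supNorm (c y') := fun y' => by
    rw [hc]; exact (supNorm_translate_centreVec hP _).symm
  have hle : ∀ y' : ↥(boxDom P), Real.exp (-(t * rhoT P y y')) ≤ Real.exp (-(t * dist (0 : Fin (d + 1) → ℤ) (c y'))) := by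
    intro y'
    rw [hρ y']
    apply Real.exp_le_exp.2
    have : dist (0 : Fin (d + 1) → ℤ) (c y') ≤ supNorm (c y') := by
      rw [dist_pi_le_iff (supNorm_nonneg _)]
      intro i
      rw [Int.dist_eq]
      have := abs_le_supNorm (c y') i
      simp only [Pi.zero_apply, Int.cast_zero, zero_sub, abs_neg]
      push_cast at this ⊢
      exact this
    nlinarith
  calc ∑ y', Real.exp (-(t * rhoT P y y')) ≤ ∑ y' : ↥(boxDom P), Real.exp (-(t * dist (0 : Fin (d + 1) → ℤ) (c y'))) :=
        Finset.sum_le_sum fun y' _ => hle y'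
    _ = ∑ z ∈ Finset.univ.image c, Real.exp (-(t * dist (0 : Fin (d + 1) → ℤ) z)) :=
        (Finset.sum_image (s := Finset.univ) (f := fun z => Real.exp (-(t * dist (0 : Fin (d + 1) → ℤ) z)))
          fun y₁ _ y₂ _ h => hinj h).symm
    _ ≤ latticeConst (d + 1) t := latticeSum_le (d + 1) ht _ 0

end Rho


end Summit.QuantumFields.BalabanUV.T4Continuum.NE7K1LinTorusRho

end
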